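import Literature.Geometry.PolyhedralFans.LinkOrbits
import HarnessLib

/-!
# Crux `FrobeniusLadder.FRationalResolution` (stmt-ResolutionOfSingularities-15317), line `redirect`,
# stub `stub_diagonalizableQuotientResolution` — the ORBIT SEPARATION LEMMA of the equivariant ladder (lane W‴, L2′)

Lineage-4 lane W‴ (memo MEMO-15317-leafhand4-g5 §5.5–5.7) reduced the ladder theorem for the ISOLATED twisted case of
`stub_diagonalizableQuotientResolution` to the weight-free equivariant statement L2′ — a `Γ`-stable regular refinement of
the isolated simplicial cone `σ` by interior lattice star subdivisions — resting on the EMPIRICAL "Conjecture S": after the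
round-0 star through the corner, every `Γ`-orbit of parallelotope points stays SEPARATED (no cone contains two of its
points), which is exactly the hypothesis of the tree's synchronised step (`Fan.multiStep_parPoints`,
`Fan.exists_regular_starIter_of_invariant`, [KempfEtAl1973] Ch. II §2 "subdivide simultaneously at all images").

This file PROVES the separation from an invariant that the synchronised step visibly preserves. Setting: `S₀` a finite
family all of whose PROPER subfamilies are regular (the isolated cone `σ = hull S₀`: every proper face regular), `Δ` a
primitively simplicial fan with every cone `≤ σ` but `σ ∉ Δ.cones` (at least one subdivision done), `g` a lattice
automorphism permuting `S₀` and carrying cones of `Δ` to cones of `Δ`, and the **interior-ray invariant**: on the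
primitive generators `K` of any cone, `t ∈ K ∖ S₀` and `g t ∈ K` force `g t = t`.

* `mem_gens_of_parCoeffs_of_mem` — a generator carrying a non-zero parallelotope coefficient of a point `z` of a cone
  `κ'` is a generator of `κ'` (the face `ρ ⊓ κ'` is generated by the common generators; tree `Fan.parPoint_face`);
* `parCoeffs_image_symm`, `sum_image_symm_eq_map` — transport of parallelotope coefficients along `g`;
* **`map_eq_self_of_mem_of_map_mem` (orbit separation)** — if a cone of `Δ` contains a parallelotope point `z` and `g z`,
  then `g z = z`. Proof: the interior generators of the carrier are pinned by the invariant, so `g z − z` is a lattice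
  vector in the `ℚ`-span of the boundary generators `S₀ ∩ K`, a PROPER subfamily of `S₀` (else `κ' = σ`), with
  coefficients `a (g⁻¹ s) − a s ∈ (−1, 1)`; regularity of the proper subfamily makes them integers, hence `0`.

Honest label: fan combinatorics for the DESIGN W‴ (Conjecture S of the memo becomes a lemma; the invariant's preservation
under the synchronised step, the round-0 corner star and the loop are NOT in this file). No stub closed by name. No
definitions, no named facts, no sorry. [cite: KempfEtAl1973, Ch. II §2] [cite: Fulton1993Toric, §2.6 p. 48]
-/

-- single-problem summit: the doubled namespace component is forced
set_option linter.dupNamespace false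

namespace Summit.ResolutionOfSingularities.ResolutionOfSingularities.Theorems.FRationalResolution.OrbitSeparation

open Literature.Geometry.PolyhedralFans PointedCone Finset

variable {κ : Type*} [Fintype κ]

/-- **A generator carrying a non-zero parallelotope coefficient of a point of `κ'` is a generator of `κ'`.** Let `ρ, κ'`
be cones of a fan with primitive simplicial generators `T, K`, `a ∈ parCoeffs T` and `z = Σ a_t t ∈ κ'`. Then every
`t` with `a t ≠ 0` (necessarily `t ∈ T`) lies in `K`: the face `ρ ⊓ κ'` carries `z`, is generated by the generators of `T` it contains
(which include the support of `a`) and equally by those of `K`. [cite: Fulton1993Toric, §2.6 p. 48] -/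
theorem mem_gens_of_parCoeffs_of_mem {Δ : Fan ℚ (κ → ℚ)} {ρ κ' : PointedCone ℚ (κ → ℚ)}
    (hρ : ρ ∈ Δ.cones) (hκ' : κ' ∈ Δ.cones) {T K : Finset (κ → ℚ)} (hT : IsPrimGens ρ T)
    (hK : IsPrimGens κ' K) {a : (κ → ℚ) → ℚ} (ha : a ∈ parCoeffs T) (hz : ∑ t ∈ T, a t • t ∈ κ')
    {t : κ → ℚ} (hat : a t ≠ 0) : t ∈ K := by
  classical
  obtain ⟨hT₁, ha₁, -⟩ := Fan.parPoint_face hρ hκ' hT ha hz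
  -- `t` is a generator of the face
  have htF : t ∈ T.filter (· ∈ ρ ⊓ κ') := by
    by_contra h
    exact hat (ha₁.2.1 t h)
  -- the face is a face of `κ' = hull K`, so its generators are among `K`
  have hface : (ρ ⊓ κ').IsFaceOf κ' := by rw [inf_comm]; exact Δ.inf_isFaceOf hκ' hρ
  have hface' : (PointedCone.hull ℚ ((T.filter (· ∈ ρ ⊓ κ') : Finset (κ → ℚ)) : Set (κ → ℚ))).IsFaceOf
      (PointedCone.hull ℚ (K : Set (κ → ℚ))) := by
    rw [← hT₁.2.2, ← hK.2.2]; exact hface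
  have heq := eq_filter_of_isFaceOf hK.1 hK.2.1 hT₁.1 hT₁.2.1 hface'
  rw [heq] at htF
  exact (Finset.mem_filter.mp htF).1

/-- Parallelotope coefficients vanish off the generating set, so `0 ≤ a x < 1` holds EVERYWHERE.
[cite: Fulton1993Toric, §2.6 p. 48] -/
theorem parCoeffs_bounds {T : Finset (κ → ℚ)} {a : (κ → ℚ) → ℚ} (ha : a ∈ parCoeffs T) (x : κ → ℚ) :
    0 ≤ a x ∧ a x < 1 := by
  by_cases hx : x ∈ T
  · exact ha.1 x hx
  · rw [ha.2.1 x hx]; exact ⟨le_rfl, zero_lt_one⟩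

omit [Fintype κ] in
/-- **Transport of a parallelotope point along a linear automorphism**: `Σ_{u ∈ g '' T} a (g⁻¹ u) • u = g (Σ_{t ∈ T} a t • t)`.
[cite: KempfEtAl1973, Ch. II §2] -/
theorem sum_image_symm_eq_map [DecidableEq (κ → ℚ)] (g : (κ → ℚ) ≃ₗ[ℚ] (κ → ℚ)) (T : Finset (κ → ℚ))
    (a : (κ → ℚ) → ℚ) :
    ∑ u ∈ T.image g, a (g.symm u) • u = g (∑ t ∈ T, a t • t) := by
  rw [Finset.sum_image fun x _ y _ h => g.injective h, map_sum]
  refine Finset.sum_congr rfl fun t _ => ?_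
  rw [g.symm_apply_apply, map_smul]

omit [Fintype κ] in
/-- **Parallelotope coefficients are transported**: if `a ∈ parCoeffs T` and `g` is a linear automorphism mapping the
image point `g (Σ a_t t)` into the lattice, then `a ∘ g⁻¹ ∈ parCoeffs (g '' T)`. [cite: KempfEtAl1973, Ch. II §2] -/
theorem parCoeffs_image_symm [DecidableEq (κ → ℚ)] (g : (κ → ℚ) ≃ₗ[ℚ] (κ → ℚ)) {T : Finset (κ → ℚ)}
    {a : (κ → ℚ) → ℚ} (ha : a ∈ parCoeffs T) (hgz : g (∑ t ∈ T, a t • t) ∈ latticeN κ) :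
    (fun u => a (g.symm u)) ∈ parCoeffs (T.image g) := by
  refine ⟨fun u hu => ?_, fun u hu => ?_, ?_⟩
  · obtain ⟨t, ht, rfl⟩ := Finset.mem_image.mp hu
    simp only [g.symm_apply_apply]
    exact ha.1 t ht
  · apply ha.2.1
    intro h
    exact hu (Finset.mem_image.mpr ⟨g.symm u, h, g.apply_symm_apply u⟩)
  · rw [sum_image_symm_eq_map]; exact hgz

/-- **ORBIT SEPARATION LEMMA (Conjecture S of memo MEMO-15317-leafhand4-g5, proved).** Let `S₀ ⊆ ℚ^κ` be a finite family all
of whose proper subfamilies are regular (the isolated simplicial cone `σ = hull S₀`), `Δ` a primitively simplicial fan with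
every cone `≤ hull S₀` and `hull S₀ ∉ Δ.cones`, and `g` a linear automorphism of `ℚ^κ` preserving the lattice in both
directions, permuting `S₀`, carrying cones of `Δ` to cones of `Δ`, and satisfying the interior-ray invariant: for the
primitive generators `K` of any cone of `Δ`, `t ∈ K`, `t ∉ S₀`, `g t ∈ K` imply `g t = t`. Then for every parallelotope
point `z = Σ a_t t` of a cone `ρ` of `Δ` and every cone `κ'` of `Δ` containing both `z` and `g z`: `g z = z` — no cone of
`Δ` contains two distinct points of the `g`-orbit of a parallelotope point, which is the separation hypothesis of the
synchronised regularisation step ([KempfEtAl1973] Ch. II §2; tree `Fan.multiStep_parPoints`).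
[cite: KempfEtAl1973, Ch. II §2] [cite: Fulton1993Toric, §2.6 p. 48] -/
theorem map_eq_self_of_mem_of_map_mem {Δ : Fan ℚ (κ → ℚ)} (hΔ : Δ.IsPrimSimplicial)
    {S₀ : Finset (κ → ℚ)} (hle : ∀ ρ ∈ Δ.cones, ρ ≤ PointedCone.hull ℚ (S₀ : Set (κ → ℚ)))
    (hσ : PointedCone.hull ℚ (S₀ : Set (κ → ℚ)) ∉ Δ.cones) (hiso : ∀ J : Finset (κ → ℚ), J ⊂ S₀ → IsRegularGens J)
    (g : (κ → ℚ) ≃ₗ[ℚ] (κ → ℚ)) (hgN : ∀ x ∈ latticeN κ, g x ∈ latticeN κ)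
    (hgN' : ∀ x ∈ latticeN κ, g.symm x ∈ latticeN κ) (hgS₀ : ∀ s ∈ S₀, g s ∈ S₀)
    (hgΔ : ∀ ρ ∈ Δ.cones, ρ.map (g : (κ → ℚ) →ₗ[ℚ] (κ → ℚ)) ∈ Δ.cones)
    (hfix : ∀ κ' ∈ Δ.cones, ∀ K : Finset (κ → ℚ), IsPrimGens κ' K → ∀ t ∈ K, t ∉ S₀ → g t ∈ K → g t = t)
    {ρ κ' : PointedCone ℚ (κ → ℚ)} (hρ : ρ ∈ Δ.cones) (hκ' : κ' ∈ Δ.cones) {T : Finset (κ → ℚ)}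
    (hT : IsPrimGens ρ T) {a : (κ → ℚ) → ℚ} (ha : a ∈ parCoeffs T) (hz : ∑ t ∈ T, a t • t ∈ κ')
    (hgz : g (∑ t ∈ T, a t • t) ∈ κ') : g (∑ t ∈ T, a t • t) = ∑ t ∈ T, a t • t := by
  classical
  set z := ∑ t ∈ T, a t • t with hzdef
  obtain ⟨K, hK⟩ := hΔ.exists_isPrimGens hκ'
  -- (1) generators of `T` with non-zero coefficient are generators of `κ'`
  have hmemK : ∀ t ∈ T, a t ≠ 0 → t ∈ K := fun t _ hat =>
    mem_gens_of_parCoeffs_of_mem hρ hκ' hT hK ha hz hat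
  -- (2) the same for the transported point `g z = Σ_{u ∈ g T} a (g⁻¹ u) • u` of the cone `g ρ`
  have hzN : z ∈ latticeN κ := ha.2.2
  have hgzN : g z ∈ latticeN κ := hgN z hzN
  have hinj : ∀ x ∈ (⊤ : Submodule ℚ (κ → ℚ)), (g : (κ → ℚ) →ₗ[ℚ] (κ → ℚ)) x = 0 → x = 0 :=
    fun x _ hx => by simpa using hx
  have hlat : ∀ x ∈ (⊤ : Submodule ℚ (κ → ℚ)), x ∈ latticeN κ → (g : (κ → ℚ) →ₗ[ℚ] (κ → ℚ)) x ∈ latticeN κ :=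
    fun x _ hx => by simpa using hgN x hx
  have hlat' : ∀ y ∈ latticeN κ, y ∈ (⊤ : Submodule ℚ (κ → ℚ)).map (g : (κ → ℚ) →ₗ[ℚ] (κ → ℚ)) →
      ∃ x ∈ (⊤ : Submodule ℚ (κ → ℚ)), x ∈ latticeN κ ∧ (g : (κ → ℚ) →ₗ[ℚ] (κ → ℚ)) x = y :=
    fun y hy _ => ⟨g.symm y, Submodule.mem_top, hgN' y hy, by simp⟩
  have hgT : IsPrimGens (ρ.map (g : (κ → ℚ) →ₗ[ℚ] (κ → ℚ))) (T.image (g : (κ → ℚ) →ₗ[ℚ] (κ → ℚ))) :=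
    isPrimGens_map hinj hlat hlat' (fun _ _ => Submodule.mem_top) hT
  have himg : T.image (g : (κ → ℚ) →ₗ[ℚ] (κ → ℚ)) = T.image g :=
    Finset.image_congr fun x _ => by simp
  rw [himg] at hgT
  have ha' : (fun u => a (g.symm u)) ∈ parCoeffs (T.image g) := parCoeffs_image_symm g ha hgzN
  have hgz' : ∑ u ∈ T.image g, a (g.symm u) • u ∈ κ' := by rw [sum_image_symm_eq_map]; exact hgz
  have hmemK' : ∀ t ∈ T, a t ≠ 0 → g t ∈ K := by
    intro t _ hat
    refine mem_gens_of_parCoeffs_of_mem (hgΔ ρ hρ) hκ' hgT hK ha' hgz' (t := g t) ?_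
    simpa using hat
  -- (3) the interior part of `z` is fixed by `g`
  have hfixT : ∀ t ∈ T, t ∉ S₀ → a t • g t = a t • t := by
    intro t ht htS
    by_cases hat : a t = 0
    · rw [hat, zero_smul, zero_smul]
    · rw [hfix κ' hκ' K hK t (hmemK t ht hat) htS (hmemK' t ht hat)]
  -- (4) split `z` into its boundary part (over `S₀`) and its interior part
  have hbd : ∑ t ∈ T.filter (· ∈ S₀), a t • t = ∑ s ∈ S₀, a s • s := by
    rw [← Finset.sum_filter_add_sum_filter_not S₀ (· ∈ T) (fun s => a s • s)]
    have hzero : ∑ s ∈ S₀.filter (fun s => ¬ s ∈ T), a s • s = 0 :=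
      Finset.sum_eq_zero fun s hs => by rw [ha.2.1 s (Finset.mem_filter.mp hs).2, zero_smul]
    rw [hzero, add_zero]
    exact Finset.sum_congr (by ext s; simp only [Finset.mem_filter]; tauto) fun _ _ => rfl
  have hbd' : ∑ t ∈ T.filter (· ∈ S₀), a t • g t = ∑ s ∈ S₀, a s • g s := by
    rw [← Finset.sum_filter_add_sum_filter_not S₀ (· ∈ T) (fun s => a s • g s)]
    have hzero : ∑ s ∈ S₀.filter (fun s => ¬ s ∈ T), a s • g s = 0 :=
      Finset.sum_eq_zero fun s hs => by rw [ha.2.1 s (Finset.mem_filter.mp hs).2, zero_smul]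
    rw [hzero, add_zero]
    exact Finset.sum_congr (by ext s; simp only [Finset.mem_filter]; tauto) fun _ _ => rfl
  have hz_split : z = ∑ s ∈ S₀, a s • s + ∑ t ∈ T.filter (fun t => ¬ t ∈ S₀), a t • t := by
    rw [hzdef, ← Finset.sum_filter_add_sum_filter_not T (· ∈ S₀) (fun t => a t • t), hbd]
  have hgz_split : g z = ∑ s ∈ S₀, a s • g s + ∑ t ∈ T.filter (fun t => ¬ t ∈ S₀), a t • t := by
    rw [hzdef, map_sum, ← Finset.sum_filter_add_sum_filter_not T (· ∈ S₀) (fun t => g (a t • t))]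
    simp only [map_smul]
    rw [hbd']
    congr 1
    exact Finset.sum_congr rfl fun t ht => hfixT t (Finset.mem_filter.mp ht).1 (Finset.mem_filter.mp ht).2
  -- (5) `g` permutes `S₀`: reindex the boundary part of `g z`
  have himS : S₀.image g = S₀ := by
    apply Finset.eq_of_subset_of_card_le
    · intro u hu
      obtain ⟨s, hs, rfl⟩ := Finset.mem_image.mp hu
      exact hgS₀ s hs
    · rw [Finset.card_image_of_injective S₀ g.injective]
  have hreidx : ∑ s ∈ S₀, a s • g s = ∑ s ∈ S₀, a (g.symm s) • s := by
    have h := sum_image_symm_eq_map g S₀ a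
    rw [himS, map_sum] at h
    rw [h]
    exact Finset.sum_congr rfl fun s _ => by rw [map_smul]
  -- (6) the difference `d = g z - z = Σ_{s ∈ S₀} c s • s`, `c s = a (g⁻¹ s) - a s ∈ (-1, 1)`
  set c : (κ → ℚ) → ℚ := fun s => a (g.symm s) - a s with hcdef
  have hd : g z - z = ∑ s ∈ S₀, c s • s := by
    rw [hgz_split, hz_split, hreidx, add_sub_add_right_eq_sub, ← Finset.sum_sub_distrib]
    exact Finset.sum_congr rfl fun s _ => by rw [hcdef, sub_smul]
  have hcb : ∀ s, -1 < c s ∧ c s < 1 := fun s => by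
    have h1 := parCoeffs_bounds ha (g.symm s)
    have h2 := parCoeffs_bounds ha s
    simp only [hcdef]
    constructor <;> linarith [h1.1, h1.2, h2.1, h2.2]
  -- (7) `c` is supported on the boundary generators `J = S₀ ∩ K`
  have hcK : ∀ s ∈ S₀, c s ≠ 0 → s ∈ K := by
    intro s hs hcs
    by_cases has : a s = 0
    · have hags : a (g.symm s) ≠ 0 := by
        intro h; apply hcs; simp only [hcdef, h, has, sub_zero]
      have hts : g.symm s ∈ T := by
        by_contra h; exact hags (ha.2.1 _ h)
      have := hmemK' (g.symm s) hts hags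
      rwa [g.apply_symm_apply] at this
    · have hsT : s ∈ T := by
        by_contra h; exact has (ha.2.1 _ h)
      exact hmemK s hsT has
  set J := S₀.filter (· ∈ K) with hJdef
  have hdJ : g z - z = ∑ s ∈ J, c s • s := by
    rw [hd, hJdef, Finset.sum_filter]
    refine Finset.sum_congr rfl fun s hs => ?_
    split_ifs with h
    · rfl
    · have : c s = 0 := by by_contra hcs; exact h (hcK s hs hcs)
      rw [this, zero_smul]
  -- (8) `J` is a PROPER subfamily of `S₀` (else `κ' = hull S₀ ∈ Δ.cones`), hence regular
  have hJss : J ⊂ S₀ := by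
    refine Finset.ssubset_iff_subset_ne.mpr ⟨Finset.filter_subset _ _, fun hJS => hσ ?_⟩
    have hsub : S₀ ⊆ K := fun s hs => by
      have : s ∈ J := hJS ▸ hs
      exact (Finset.mem_filter.mp this).2
    have hle' : PointedCone.hull ℚ (S₀ : Set (κ → ℚ)) ≤ κ' := by
      rw [hK.2.2]
      exact Submodule.span_mono (Finset.coe_subset.mpr hsub)
    have heq : κ' = PointedCone.hull ℚ (S₀ : Set (κ → ℚ)) := le_antisymm (hle κ' hκ') hle'
    rw [← heq]; exact hκ'
  have hJreg : IsRegularGens J := hiso J hJss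
  -- (9) `d` is a lattice point of the `ℚ`-span of `J`, so an INTEGRAL combination of `J`; compare coefficients
  have hdN : g z - z ∈ latticeN κ := Submodule.sub_mem _ hgzN hzN
  have hdQ : g z - z ∈ Submodule.span ℚ (J : Set (κ → ℚ)) := by rw [hdJ]; exact sum_smul_mem_span J c
  have hdZ := hJreg.2.2 _ hdN hdQ
  obtain ⟨f, -, hf⟩ := Submodule.mem_span_finset.mp hdZ
  have hf' : ∑ j ∈ J, ((f j : ℤ) : ℚ) • j = ∑ j ∈ J, c j • j := by
    rw [← hdJ, ← hf]
    exact Finset.sum_congr rfl fun j _ => by rw [Int.cast_smul_eq_zsmul]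
  have hczero : ∀ j ∈ J, c j = 0 := by
    intro j hj
    have hfj := eq_on_of_sum_smul_eq hJreg.2.1 hf' j hj
    obtain ⟨h0, h1⟩ := hcb j
    rw [← hfj] at h0 h1 ⊢
    have h0' : (-1 : ℤ) < f j := by exact_mod_cast h0
    have h1' : f j < 1 := by exact_mod_cast h1
    have : f j = 0 := by omega
    rw [this, Int.cast_zero]
  have hd0 : g z - z = 0 := by
    rw [hdJ]; exact Finset.sum_eq_zero fun j hj => by rw [hczero j hj, zero_smul]
  exact sub_eq_zero.mp hd0

end Summit.ResolutionOfSingularities.ResolutionOfSingularities.Theorems.FRationalResolution.OrbitSeparation
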